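import Literature.AlgebraicGeometry.HilbertScheme.TranslationActionCohomology
import Literature.AlgebraicGeometry.Hyperkaehler.GeneralizedKummerTypeTranslationGroup
import HarnessLib

/-!
# `Γ(Kⁿ(A))` = the Kummer translations `τ_b`, `b ∈ A[n+1]` (named fact) and their trivial action on `im θ^*`
(proved)

Layer `Literature/AlgebraicGeometry/Hyperkaehler`; rider on `GeneralizedKummerTypeTranslationGroup` (the subgroup
`Γ(X) = autFixingH2H3 X ⊂ Aut X` of automorphisms acting trivially on `H²(X(ℂ); ℂ)` and `H³(X(ℂ); ℂ)`, and the
REFEREED record `FloccariVaresco2024_autFixingH2H3_equiv_kumType`: `Γ(X) ≃ (ℤ/(n+1))⁴` abstractly for every `X` of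
`Kumⁿ`-type, `n ≥ 2`) and on `HilbertScheme/HilbertSchemeTranslationAction` (the translation action `act` of `A` on
a Hilbert scheme `(H, Ξ) = A^[n+1]`, the translations `translateHilb act b = t_b^{[n+1]}`, and the Kummer translations
`IsKummerTranslation act j b τ : τ ≫ j = j ≫ t_b^{[n+1]}` of a Kummer fibre `j : K ⟶ H`).  This file PINS the
abstract record AT THE KUMMER POINT, which is what the lane-(V) bridge "`im θ^* = H*(K)^{Γ(K)}`" consumes:

* NAMED FACT `BNWS2011_autFixingH2H3_generalizedKummer` — for an abelian surface `A`, `n ≥ 2`, a Hilbert scheme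
  `(H, Ξ)` of `n + 1` points with its translation action `act`, and a Kummer fibre `j : K ⟶ H` (`K` smooth projective
  of dimension `2n`): (1) for every `b` with `b^{n+1} = 1` and every Kummer translation `τ` by `b`, `τ` is an
  automorphism of `K` acting as the identity on `H²(K(ℂ); ℂ)` and on `H³(K(ℂ); ℂ)`; (2) every `g ∈ Γ(K)` is the Kummer
  translation by some `b` with `b^{n+1} = 1`.  PRINT (three REFEREED sources, read):
  Boissière–Nieper-Wißkirchen–Sarti, JMPA 95 (2011) §3.1 ("the translation `t_a` by `a` in `A` induces an
  automorphism of `A^{[n]}` that restricts to `K_n(A)` if and only if `a` is an `n`-torsion point") and Cor. 3.3 (2)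
  ("The kernel of the map `Aut(K_n(A)) → O(H²(K_n(A), ℤ))`, `f ↦ f^*` is isomorphic to `Tors_n(A) ⋊ ℤ/2ℤ`", with,
  in the proof: "the
  translation by `a` on `A` induces an automorphism `t_a^{⟦n⟧}` acting as the identity on `H²(K_n(A), ℤ)`: since the
  automorphism `t_a^{[n]}` induced on `A^{[n]}` is homotopic to the identity and the restriction map
  `H²(A^{[n]}, ℂ) → H²(K_n(A), ℂ)` is surjective", `n ≥ 3` in their indexing `K_n(A) ⊂ A^{[n]}` = our `n + 1`);
  Oguiso, Nagoya Math. J. 239 (2020) Lemma 3.4 ("Let `g ∈ K ∖ T(n)` [the coset of `ι`] … Then `g^* τ = −τ`. In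
  particular … `g^* | H³(X, ℂ) ≠ id`"); Foster, Eur. J. Math. 10 (2024) Lemma 85 and its proof ("if
  `k < 2(n+1)(j−1)/j`, then `H^k(A × Kum_n(A), ℚ)` is `Γ`-invariant and by the Künneth theorem this implies that
  `H^k(Kum_n(A), ℚ)` is `Γ`-invariant as well", `Γ ≅ A[n+1]` the translations, `j` the smallest prime factor of
  `n + 1`; `k = 3 < 2(n+1)(j−1)/j` for every `n ≥ 2`).  Clause (1) = BNWS §3.1 + the quoted sentence of the proof of
  Cor. 3.3 (degree `2`) + Foster Lemma 85 (degree `3`); clause (2) = BNWS Cor. 3.3 (2) (= Oguiso Thm. 1.2: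
  "`Ker (ρ₂ : Aut(K_{n−1}(A)) → GL(H²(K_{n−1}(A), ℤ))) = T(n)·⟨ι⟩`"; "`H²(K_n(A), ℤ)` has no torsion" [BNWS, proof
  of Cor. 3.3], so acting trivially on `H²(K(ℂ); ℂ)` is acting trivially on `H²(K, ℤ)`) ∩ Oguiso Lemma 3.4 (the
  coset of `ι` does not act trivially on `H³(K, ℂ)`).  PRINT-SYNTHESIS of three refereed statements; unproved in the
  tree.
* PROVED, fact-free (from `IsTranslationAction.complexBetti_map_translateHilb`: `(t_b^{[n+1]})^* = 𝟙`, homotopy):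
  `IsKummerTranslation.complexBetti_map_comp_pullback` — **a Kummer translation fixes `im θ^*` pointwise**:
  `θ^* ≫ τ^* = θ^*` on `Hᵏ`, every `k` (BNWS's argument, all degrees).
* PROVED modulo the fact: `BNWS2011_autFixingH2H3_generalizedKummer.complexBetti_map_comp_pullback_of_mem` —
  **`Γ(K)` fixes `im θ^*` pointwise in every degree** (the inclusion `im θ^* ⊆ H*(K)^{Γ(K)}` of the bridge), and
  `.isIso`, `.mem_autFixingH2H3` (a Kummer translation, as an automorphism, lies in `Γ(K)`).

Indexing: the tree's `IsGeneralizedKummerVarietyOf n A K` has `K = Kⁿ(A) ⊂ A^[n+1]`, `dim K = 2n` (Beauville's `K_n`;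
BNWS's `K_{n+1}(A)`; Oguiso's `K_n(A) ⊂ Hilb^{n+1}`); the Kummer fibre is cut out by the Albanese difference map at a
base point `x₀` (any fibre of Beauville's `S`; BNWS/Oguiso take `S⁻¹(0)` — all fibres are translates of one another
by `t_c^{[n+1]}`, which commutes with the action, so the statements transport verbatim; the same reading as
`HilbertScheme.Beauville1983_kummerCover_galois`).

## Not here

The bridge itself (`im θ^* = H*(K)^{Γ}`: needs the Galois cover `Θ`, `HilbertScheme.Beauville1983_kummerCover_galois`,
the tree's finite-cover transfer and Künneth — prover work); `Aut(Kⁿ(A)) → O(H²)` beyond its kernel; `n = 1`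
(the Kummer surface, where `A[2]` moves `H²`).
-/

noncomputable section

open CategoryTheory MonoidalCategory CartesianMonoidalCategory
open Literature.AlgebraicGeometry.Motives (SchemeOver AbelianVariety ComplexPoints)
open Literature.AlgebraicGeometry.HodgeTheory (complexBetti)
open Literature.AlgebraicGeometry.HilbertScheme
open scoped MonObj

namespace Literature.AlgebraicGeometry.Hyperkaehler

/-! ### The named fact -/

/-- **Boissière–Nieper-Wißkirchen–Sarti 2011 + Oguiso 2020 + Foster 2024: the automorphisms of a generalized Kummer
variety `K = Kⁿ(A)` (`n ≥ 2`) acting trivially on `H²` and `H³` are exactly the Kummer translations `τ_b`,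
`b ∈ A[n+1]`.**  For an abelian surface `A`, `n ≥ 2`, a Hilbert scheme `(H, Ξ)` of `n + 1` points of `A` (smooth
projective of dimension `2(n+1)`) with translation action `act`, and a Kummer fibre `j : K ⟶ H` (fibre of the Albanese
difference map over the unit; `K` smooth projective of dimension `2n`): (1) for every point `b` of `A` with
`b^{n+1} = 1` and every `τ : K ⟶ K` with `τ ≫ j = j ≫ t_b^{[n+1]}`, `τ` is an automorphism of `K` inducing the
identity on `H²(K(ℂ); ℂ)` and on `H³(K(ℂ); ℂ)` ("`t_a` … induces an automorphism of `A^{[n]}` that restricts to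
`K_n(A)` iff `a` is an `n`-torsion point"; "`t_a^{⟦n⟧}` acting as the identity on `H²(K_n(A), ℤ)`";
"`H^k(Kum_n(A), ℚ)` is `Γ`-invariant" for `k < 2(n+1)(j−1)/j`, in particular `k = 3`); (2) every automorphism `g`
of `K` acting trivially on `H²` and `H³` (`g ∈ autFixingH2H3 K`) is such a Kummer translation ("The kernel of
`Aut(K_n(A)) → O(H²(K_n(A), ℤ))` is isomorphic to `Tors_n(A) ⋊ ℤ/2ℤ`"; "`H²(K_n(A), ℤ)` has no torsion"; and the
coset of `ι` acts as `−1` on a non-zero class of `H³(K, ℂ)`: "`g^* τ = −τ`").  PRINT-SYNTHESIS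
of three refereed statements; unproved in the tree.
[cite: BoissiereNieperWisskirchenSarti2011, §3.1 and Cor. 3.3 (1)–(2) with its proof]
[cite: Oguiso2020CohomologicallyTrivialKummer, Thm. 1.2 and Lemma 3.4] [cite: Foster2024, Lemma 85 (proof)] -/
def BNWS2011_autFixingH2H3_generalizedKummer : Prop :=
  ∀ ⦃n : ℕ⦄ ⦃A : AbelianVariety ℂ⦄ ⦃K H : SchemeOver ℂ⦄, A.dim = 2 → 2 ≤ n →
    ∀ (Ξ : (A.X ⊗ H).left.IdealSheafData) (𝒜 : Motives.Jacobian H) (x₀ : 𝟙_ (SchemeOver ℂ) ⟶ H) (j : K ⟶ H)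
      (act : A.X ⊗ H ⟶ H), IsHilbertSchemeOfPoints (n + 1) A.X H Ξ →
      Motives.IsSmoothProjective (2 * (n + 1)) H →
      IsPullback j (toUnit K) (lift (𝟙 H) (toUnit H ≫ x₀) ≫ 𝒜.diff) (1 : 𝟙_ (SchemeOver ℂ) ⟶ 𝒜.J.X) →
      Motives.IsSmoothProjective (2 * n) K → IsTranslationAction Ξ act →
      (∀ (b : 𝟙_ (SchemeOver ℂ) ⟶ A.X) (τ : K ⟶ K), b ^ (n + 1) = 1 → IsKummerTranslation act j b τ →
          IsIso τ ∧ complexBetti.map τ 2 = 𝟙 _ ∧ complexBetti.map τ 3 = 𝟙 _) ∧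
      (∀ g : Aut K, g ∈ autFixingH2H3 K →
          ∃ b : 𝟙_ (SchemeOver ℂ) ⟶ A.X, b ^ (n + 1) = 1 ∧ IsKummerTranslation act j b g.hom)

/-! ### Kummer translations fix `im θ^*` (fact-free) -/

section Kernel

variable {A : AbelianVariety ℂ} {K H : SchemeOver ℂ} {n : ℕ} {Ξ : (A.X ⊗ H).left.IdealSheafData}
  {act : A.X ⊗ H ⟶ H} {j : K ⟶ H}

/-- **A Kummer translation fixes the image of `θ^* : Hᵏ(A^[n+1]) → Hᵏ(K)` pointwise, in every degree**:
`θ^* ≫ τ_b^* = θ^*`, because `τ_b ≫ j = j ≫ t_b^{[n+1]}` and `(t_b^{[n+1]})^* = 𝟙` (the translation is homotopic to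
the identity — `IsTranslationAction.complexBetti_map_translateHilb`).  Fact-free; `b` need not be torsion.
[cite: BoissiereNieperWisskirchenSarti2011, Cor. 3.3 (proof of (2))] [cite: Beauville1983, §7 p. 769] -/
theorem _root_.Literature.AlgebraicGeometry.HilbertScheme.IsKummerTranslation.complexBetti_map_comp_pullback
    (hH : IsHilbertSchemeOfPoints n A.X H Ξ) (hact : IsTranslationAction Ξ act) {b : 𝟙_ (SchemeOver ℂ) ⟶ A.X}
    {τ : K ⟶ K} (hτ : IsKummerTranslation act j b τ) (k : ℕ) :
    complexBetti.map j k ≫ complexBetti.map τ k = complexBetti.map j k := by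
  have h := congrArg (fun f ↦ complexBetti.map f k) hτ
  simp only [HodgeTheory.complexBetti.map_comp] at h
  rw [h, hact.complexBetti_map_translateHilb hH b k, Category.id_comp]

/-- Pointwise form: `τ_b^*(θ^* x) = θ^* x`. [cite: BoissiereNieperWisskirchenSarti2011, Cor. 3.3 (proof of (2))] -/
theorem _root_.Literature.AlgebraicGeometry.HilbertScheme.IsKummerTranslation.complexBetti_map_pullback_apply
    (hH : IsHilbertSchemeOfPoints n A.X H Ξ) (hact : IsTranslationAction Ξ act) {b : 𝟙_ (SchemeOver ℂ) ⟶ A.X}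
    {τ : K ⟶ K} (hτ : IsKummerTranslation act j b τ) (k : ℕ) (x : complexBetti H k) :
    complexBetti.map τ k (complexBetti.map j k x) = complexBetti.map j k x := by
  change (complexBetti.map j k ≫ complexBetti.map τ k) x = _
  rw [hτ.complexBetti_map_comp_pullback hH hact k]

end Kernel

/-! ### Consequences of the fact -/

namespace BNWS2011_autFixingH2H3_generalizedKummer

variable {n : ℕ} {A : AbelianVariety ℂ} {K H : SchemeOver ℂ} {Ξ : (A.X ⊗ H).left.IdealSheafData}
  {𝒜 : Motives.Jacobian H} {x₀ : 𝟙_ (SchemeOver ℂ) ⟶ H} {j : K ⟶ H} {act : A.X ⊗ H ⟶ H}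

/-- A Kummer translation by a torsion point is an automorphism of `K`.
[cite: BoissiereNieperWisskirchenSarti2011, §3.1] -/
theorem isIso (h : BNWS2011_autFixingH2H3_generalizedKummer) (hA : A.dim = 2) (hn : 2 ≤ n)
    (hH : IsHilbertSchemeOfPoints (n + 1) A.X H Ξ) (hHs : Motives.IsSmoothProjective (2 * (n + 1)) H)
    (hsq : IsPullback j (toUnit K) (lift (𝟙 H) (toUnit H ≫ x₀) ≫ 𝒜.diff) (1 : 𝟙_ (SchemeOver ℂ) ⟶ 𝒜.J.X))
    (hKs : Motives.IsSmoothProjective (2 * n) K) (hact : IsTranslationAction Ξ act)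
    {b : 𝟙_ (SchemeOver ℂ) ⟶ A.X} (hb : b ^ (n + 1) = 1) {τ : K ⟶ K} (hτ : IsKummerTranslation act j b τ) :
    IsIso τ :=
  ((h hA hn Ξ 𝒜 x₀ j act hH hHs hsq hKs hact).1 b τ hb hτ).1

/-- **A Kummer translation by a torsion point, as an automorphism of `K`, lies in `Γ(K)`.**
[cite: BoissiereNieperWisskirchenSarti2011, Cor. 3.3 (proof of (2))] [cite: Foster2024, Lemma 85 (proof)] -/
theorem mem_autFixingH2H3 (h : BNWS2011_autFixingH2H3_generalizedKummer) (hA : A.dim = 2) (hn : 2 ≤ n)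
    (hH : IsHilbertSchemeOfPoints (n + 1) A.X H Ξ) (hHs : Motives.IsSmoothProjective (2 * (n + 1)) H)
    (hsq : IsPullback j (toUnit K) (lift (𝟙 H) (toUnit H ≫ x₀) ≫ 𝒜.diff) (1 : 𝟙_ (SchemeOver ℂ) ⟶ 𝒜.J.X))
    (hKs : Motives.IsSmoothProjective (2 * n) K) (hact : IsTranslationAction Ξ act)
    {b : 𝟙_ (SchemeOver ℂ) ⟶ A.X} (hb : b ^ (n + 1) = 1) {τ : K ⟶ K} (hτ : IsKummerTranslation act j b τ) :
    haveI := isIso h hA hn hH hHs hsq hKs hact hb hτ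
    (asIso τ : Aut K) ∈ autFixingH2H3 K := by
  obtain ⟨-, h2, h3⟩ := (h hA hn Ξ 𝒜 x₀ j act hH hHs hsq hKs hact).1 b τ hb hτ
  exact ⟨h2, h3⟩

/-- **`Γ(K)` fixes the image of `θ^*` pointwise, in every degree** (`im θ^* ⊆ H*(K)^{Γ(K)}`, the easy inclusion of
the bridge): every `g ∈ Γ(K)` is a Kummer translation (clause (2) of the fact), and Kummer translations fix `im θ^*`
(`IsKummerTranslation.complexBetti_map_comp_pullback`, homotopy).
[cite: BoissiereNieperWisskirchenSarti2011, Cor. 3.3] [cite: Oguiso2020CohomologicallyTrivialKummer, Lemma 3.4] -/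
theorem complexBetti_map_comp_pullback_of_mem (h : BNWS2011_autFixingH2H3_generalizedKummer) (hA : A.dim = 2)
    (hn : 2 ≤ n) (hH : IsHilbertSchemeOfPoints (n + 1) A.X H Ξ) (hHs : Motives.IsSmoothProjective (2 * (n + 1)) H)
    (hsq : IsPullback j (toUnit K) (lift (𝟙 H) (toUnit H ≫ x₀) ≫ 𝒜.diff) (1 : 𝟙_ (SchemeOver ℂ) ⟶ 𝒜.J.X))
    (hKs : Motives.IsSmoothProjective (2 * n) K) (hact : IsTranslationAction Ξ act) {g : Aut K}
    (hg : g ∈ autFixingH2H3 K) (k : ℕ) :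
    complexBetti.map j k ≫ complexBetti.map g.hom k = complexBetti.map j k := by
  obtain ⟨b, -, hτ⟩ := (h hA hn Ξ 𝒜 x₀ j act hH hHs hsq hKs hact).2 g hg
  exact hτ.complexBetti_map_comp_pullback hH hact k

/-- Pointwise form: `g^*(θ^* x) = θ^* x` for `g ∈ Γ(K)`. [cite: BoissiereNieperWisskirchenSarti2011, Cor. 3.3] -/
theorem complexBetti_map_pullback_apply_of_mem (h : BNWS2011_autFixingH2H3_generalizedKummer) (hA : A.dim = 2)
    (hn : 2 ≤ n) (hH : IsHilbertSchemeOfPoints (n + 1) A.X H Ξ) (hHs : Motives.IsSmoothProjective (2 * (n + 1)) H)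
    (hsq : IsPullback j (toUnit K) (lift (𝟙 H) (toUnit H ≫ x₀) ≫ 𝒜.diff) (1 : 𝟙_ (SchemeOver ℂ) ⟶ 𝒜.J.X))
    (hKs : Motives.IsSmoothProjective (2 * n) K) (hact : IsTranslationAction Ξ act) {g : Aut K}
    (hg : g ∈ autFixingH2H3 K) (k : ℕ) (x : complexBetti H k) :
    complexBetti.map g.hom k (complexBetti.map j k x) = complexBetti.map j k x := by
  change (complexBetti.map j k ≫ complexBetti.map g.hom k) x = _
  rw [complexBetti_map_comp_pullback_of_mem h hA hn hH hHs hsq hKs hact hg k]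

end BNWS2011_autFixingH2H3_generalizedKummer

end Literature.AlgebraicGeometry.Hyperkaehler

end
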